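import Summits.Ventures.Crystal3D.Theorems.StickyWulffConstantTextureBuildCells
import HarnessLib

/-!
# TB-D assembly, part 18: SEMANTICS OF THE LABELLING RULE — which cells get which class
# (lane T, crux `TextureLiminfV5`, stmt-Ventures-23912; blueprint TexShadowTB.lean, towards `stub_LT` / `stub_LP1`)

HONEST FRAMING. Venture `Summits/Ventures/Crystal3D` (cell `crystal3d-full`), route `route-Ventures-StickyWulffConstant`, helper `--supports` the
law-v5 crux `TextureLiminfV5` (stmt-Ventures-23912).  Elementary lemmas about the definitions of …TextureBuildCells (census-free, standard axioms); F-C1 not moved.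

* `subset_T_of_cell_subset` / `cell_subset_of_subset_T` — for a NONEMPTY cell with positive part `T ⊆ 𝓗` and constraints `G ⊆ 𝓗`: `cell ⊆ polytope G ↔ G ⊆ T`;
* `grainOf_eq_some_of_tent` — a nonempty cell inside a certificate piece of grain `f` and inside `f`'s territory, and inside no core, has grain `f`
  (uniqueness of the grain: territories of different grains are disjoint, `hDD`);
* `grainOf_core` — a cell inside a core of `f` has grain `f`; `grainOf_tent_ne` — the tent branch never yields another grain;
* `slabOf_eq_some` — a nonempty cell inside the own slab `i ∈ slabWindow f` has `slabOf f = some i` (slabs are disjoint);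
* `lab₀_eq_of_tent` — hence such a tent cell is labelled with the class `(f, i)`;
* `subset_G_of_labelled_meets_U` — a LABELLED cell meeting the free zone `U_f` lies inside the tent solid `(ct f).G` (the core / prism / gap / box
  branches are excluded by `hU`, `hDP`, `hQD`, `hBD`, `hCD`).
-/

noncomputable section

open scoped BigOperators InnerProductSpace

namespace Summit.Ventures.Crystal3D.Cruxes.TextureLiminf.TexShadow

open Summit.Ventures.Crystal3D Summit.Ventures.Crystal3D.Theorems MeasureTheory Set

/-! ### Cells versus polytopes cut out by arrangement planes -/

/-- A nonempty cell inside `polytope G` (`G ⊆ 𝓗`) has `G` in its positive part. -/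
theorem subset_T_of_cell_subset {𝓗 T G : Finset (E3 × ℝ)} (hG : G ⊆ 𝓗) (hne : (polytope (signedH 𝓗 T)).Nonempty)
    (h : polytope (signedH 𝓗 T) ⊆ polytope G) : G ⊆ T := by
  intro p hp
  obtain ⟨x, hx⟩ := hne
  have hxG : x ∈ polytope G := h hx
  simp only [polytope, mem_iInter, mem_setOf_eq] at hxG
  have hlt := hxG p hp
  rw [mem_polytope_signedH_iff] at hx
  by_contra hpT
  exact lt_asymm hlt ((hx p (hG hp)).2 hpT)

/-- A cell whose positive part contains `G ⊆ 𝓗` lies inside `polytope G`. -/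
theorem cell_subset_of_subset_T {𝓗 T G : Finset (E3 × ℝ)} (hG : G ⊆ 𝓗) (h : G ⊆ T) : polytope (signedH 𝓗 T) ⊆ polytope G := by
  intro x hx
  rw [mem_polytope_signedH_iff] at hx
  simp only [polytope, mem_iInter, mem_setOf_eq]
  exact fun p hp => (hx p (hG hp)).1 (h hp)

namespace TexInput

variable {C R₀ : ℝ} {N : ℕ} {x : Fin N → E3} {rc : RiseredCover C R₀ N x} {δ : ℝ} {μ : Mesh₅ rc δ} (I : TexInput rc μ)

/-! ### Membership of the mesh data in `𝓗` -/

/-- Territory data are arrangement data. -/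
theorem HD_subset_𝓗 (f : Fin rc.ng) (j : Fin (μ.nD f)) : μ.HD f j ⊆ I.𝓗 := fun p hp => by
  simp only [𝓗, Finset.mem_union, Finset.mem_biUnion, Finset.mem_univ, true_and]
  exact Or.inl (Or.inl (Or.inl (Or.inl (Or.inl (Or.inl (Or.inl ⟨f, j, hp⟩))))))

/-- Core data are arrangement data. -/
theorem HC_subset_𝓗 (f : Fin rc.ng) (j : Fin (μ.nC f)) : μ.HC f j ⊆ I.𝓗 := fun p hp => by
  simp only [𝓗, Finset.mem_union, Finset.mem_biUnion, Finset.mem_univ, true_and]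
  exact Or.inl (Or.inl (Or.inl (Or.inl (Or.inl (Or.inl (Or.inr ⟨f, j, hp⟩))))))

/-- Prism data are arrangement data. -/
theorem HP_subset_𝓗 (k : Fin rc.nk) : μ.HP k ⊆ I.𝓗 := fun p hp => by
  simp only [𝓗, Finset.mem_union, Finset.mem_biUnion, Finset.mem_univ, true_and]
  exact Or.inl (Or.inl (Or.inl (Or.inl (Or.inl (Or.inr ⟨k, Or.inl hp⟩)))))

/-- Gap-piece data are arrangement data. -/
theorem HQ_subset_𝓗 (l : Fin μ.nQ) : μ.HQ l ⊆ I.𝓗 := fun p hp => by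
  simp only [𝓗, Finset.mem_union, Finset.mem_biUnion, Finset.mem_univ, true_and]
  exact Or.inl (Or.inl (Or.inl (Or.inl (Or.inr ⟨l, hp⟩))))

/-- Riser-box data are arrangement data. -/
theorem HB_subset_𝓗 (r : Fin rc.nr) : μ.HB r ⊆ I.𝓗 := fun p hp => by
  simp only [𝓗, Finset.mem_union, Finset.mem_biUnion, Finset.mem_univ, true_and]
  exact Or.inl (Or.inl (Or.inl (Or.inr ⟨r, hp⟩)))

/-- Certificate-piece data are arrangement data. -/
theorem certH_subset_𝓗 (f : Fin rc.ng) (j : Fin (I.ct f).J) : (I.ct f).H j ⊆ I.𝓗 := fun p hp => by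
  simp only [𝓗, Finset.mem_union, Finset.mem_biUnion, Finset.mem_univ, true_and]
  exact Or.inl (Or.inl (Or.inr ⟨f, j, hp⟩))

/-- Window-slab data are arrangement data. -/
theorem laySlabH_subset_𝓗 (f : Fin rc.ng) {i : ℤ} (hi : i ∈ I.slabWindow f) : laySlabH (rc.tent f).L (rc.tent f).s i ⊆ I.𝓗 := fun p hp => by
  simp only [𝓗, Finset.mem_union, Finset.mem_biUnion, Finset.mem_univ, true_and, slabData]
  exact Or.inl (Or.inr ⟨f, i, hi, hp⟩)

/-! ### The grain of a cell -/

/-- Two grains whose territories both contain a nonempty set are equal. -/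
theorem grain_eq_of_subset_HD {f f' : Fin rc.ng} {j : Fin (μ.nD f)} {j' : Fin (μ.nD f')} {Z : Set E3} (hne : Z.Nonempty)
    (h : Z ⊆ polytope (μ.HD f j)) (h' : Z ⊆ polytope (μ.HD f' j')) : f = f' := by
  by_contra hff'
  obtain ⟨z, hz⟩ := hne
  have hd := μ.hDD f f' hff'
  exact Set.disjoint_left.1 hd (mem_iUnion.2 ⟨j, h hz⟩) (mem_iUnion.2 ⟨j', h' hz⟩)

/-- **The tent branch**: a nonempty cell inside no core, inside a certificate piece of `f` and inside `f`'s territory, has grain `f`. -/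
theorem grainOf_eq_some_of_tent {T : Finset (E3 × ℝ)} (hne : (polytope (signedH I.𝓗 T)).Nonempty)
    (hcore : ¬ ∃ f : Fin rc.ng, ∃ j, μ.HC f j ⊆ T) {f : Fin rc.ng}
    (htent : ∃ j, (I.ct f).H j ⊆ T) (hterr : ∃ j', μ.HD f j' ⊆ T) : I.grainOf T = some f := by
  classical
  have hex : ∃ f : Fin rc.ng, (∃ j, (I.ct f).H j ⊆ T) ∧ ∃ j', μ.HD f j' ⊆ T := ⟨f, htent, hterr⟩
  unfold grainOf
  rw [dif_neg hcore, dif_pos hex]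
  congr 1
  obtain ⟨-, j'', hj''⟩ := Classical.choose_spec hex
  obtain ⟨j', hj'⟩ := hterr
  exact grain_eq_of_subset_HD hne (cell_subset_of_subset_T (I.HD_subset_𝓗 _ j'') hj'') (cell_subset_of_subset_T (I.HD_subset_𝓗 f j') hj')

/-! ### The own slab of a cell -/

/-- **The slab branch**: a nonempty cell whose positive part contains the constraints of the own slab `i ∈ slabWindow f` has `slabOf f = some i`. -/
theorem slabOf_eq_some {T : Finset (E3 × ℝ)} (hne : (polytope (signedH I.𝓗 T)).Nonempty) {f : Fin rc.ng} {i : ℤ} (hi : i ∈ I.slabWindow f)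
    (h : laySlabH (rc.tent f).L (rc.tent f).s i ⊆ T) : I.slabOf f T = some ⟨i, hi⟩ := by
  classical
  have hex : ∃ i' : {i : ℤ // i ∈ I.slabWindow f}, laySlabH (rc.tent f).L (rc.tent f).s i'.1 ⊆ T := ⟨⟨i, hi⟩, h⟩
  unfold slabOf
  rw [dif_pos hex]
  congr 1
  apply Subtype.ext
  have hspec := Classical.choose_spec hex
  set i' := Classical.choose hex with hi'
  -- the cell lies in both slabs, which are disjoint unless equal
  have h1 : polytope (signedH I.𝓗 T) ⊆ laySlab (rc.tent f).L (rc.tent f).s i'.1 := by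
    rw [laySlab_eq_polytope]; exact cell_subset_of_subset_T (I.laySlabH_subset_𝓗 f i'.2) hspec
  have h2 : polytope (signedH I.𝓗 T) ⊆ laySlab (rc.tent f).L (rc.tent f).s i := by
    rw [laySlab_eq_polytope]; exact cell_subset_of_subset_T (I.laySlabH_subset_𝓗 f hi) h
  by_contra hii
  obtain ⟨z, hz⟩ := hne
  exact Set.disjoint_left.1 (TentCertificate.disjoint_laySlab (rc.tent f).L (rc.tent f).s hii) (h1 hz) (h2 hz)

/-- **The class of a tent cell**: grain `f` by the tent branch and own slab `i` ⇒ label `enc (f, i)`. -/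
theorem lab₀_eq_of_tent {T : Finset (E3 × ℝ)} (hne : (polytope (signedH I.𝓗 T)).Nonempty)
    (hcore : ¬ ∃ f : Fin rc.ng, ∃ j, μ.HC f j ⊆ T) {f : Fin rc.ng} (htent : ∃ j, (I.ct f).H j ⊆ T) (hterr : ∃ j', μ.HD f j' ⊆ T)
    {i : ℤ} (hi : i ∈ I.slabWindow f) (hslab : laySlabH (rc.tent f).L (rc.tent f).s i ⊆ T) :
    I.lab₀ T = some (I.enc ⟨f, ⟨i, hi⟩⟩) := by
  unfold lab₀
  rw [I.grainOf_eq_some_of_tent hne hcore htent hterr, Option.bind_some, I.slabOf_eq_some hne hi hslab, Option.map_some]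

/-! ### Labelled cells meeting a free zone lie in the tent solid -/

/-- A set inside a core of `f` does not meet the free zone `U_f`. -/
theorem disjoint_U_of_subset_HC {f : Fin rc.ng} {j : Fin (μ.nC f)} {Z : Set E3} (h : Z ⊆ polytope (μ.HC f j)) : Disjoint Z (rc.tent f).U := by
  rw [μ.hU f, Set.disjoint_left]
  intro z hz hzU
  exact hzU.2 (subset_closure (mem_iUnion.2 ⟨j, h hz⟩))

/-- A set inside the territory of `f'` and meeting the territory of `f` forces `f' = f`. -/
theorem grain_eq_of_subset_D_of_meets {f f' : Fin rc.ng} {Z : Set E3} (h' : Z ⊆ ⋃ j, polytope (μ.HD f' j)) {z : E3} (hz : z ∈ Z)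
    (hzf : z ∈ ⋃ j, polytope (μ.HD f j)) : f' = f := by
  by_contra hff'
  exact Set.disjoint_left.1 (μ.hDD f' f hff') (h' hz) hzf

/-- **A labelled cell meeting the free zone `U_f` lies inside the tent solid of `f`.** -/
theorem subset_G_of_labelled_meets_U {T : Finset (E3 × ℝ)} (hlab : (I.lab₀ T).isSome = true) {f : Fin rc.ng} {z : E3}
    (hz : z ∈ polytope (signedH I.𝓗 T)) (hzU : z ∈ (rc.tent f).U) : polytope (signedH I.𝓗 T) ⊆ (I.ct f).G := by
  classical
  have hne : (polytope (signedH I.𝓗 T)).Nonempty := ⟨z, hz⟩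
  have hzD : z ∈ ⋃ j, polytope (μ.HD f j) := by
    have := hzU; rw [μ.hU f] at this; exact this.1
  -- unfold the labelling rule far enough to see which branch fired
  have hgrain : (I.grainOf T).isSome = true := by
    unfold lab₀ at hlab
    cases h : I.grainOf T with
    | none => rw [h] at hlab; simp at hlab
    | some g => rfl
  unfold grainOf at hgrain
  -- core branch impossible: the cell meets `U_f`
  have hcore : ¬ ∃ f' : Fin rc.ng, ∃ j, μ.HC f' j ⊆ T := by
    rintro ⟨f', j, hj⟩
    have hsub : polytope (signedH I.𝓗 T) ⊆ polytope (μ.HC f' j) := cell_subset_of_subset_T (I.HC_subset_𝓗 f' j) hj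
    have hf' : f' = f := grain_eq_of_subset_D_of_meets (hsub.trans (μ.hCD f' j)) hz hzD
    subst hf'
    exact Set.disjoint_left.1 (disjoint_U_of_subset_HC hsub) hz hzU
  rw [dif_neg hcore] at hgrain
  by_cases htent : ∃ f' : Fin rc.ng, (∃ j, (I.ct f').H j ⊆ T) ∧ ∃ j', μ.HD f' j' ⊆ T
  · -- tent branch: the grain is `f`, the cell lies in a certificate piece of `f`
    obtain ⟨f', ⟨j, hj⟩, ⟨j', hj'⟩⟩ := htent
    have hsubD : polytope (signedH I.𝓗 T) ⊆ ⋃ j, polytope (μ.HD f' j) :=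
      (cell_subset_of_subset_T (I.HD_subset_𝓗 f' j') hj').trans (subset_iUnion (fun j => polytope (μ.HD f' j)) j')
    have hf' : f' = f := grain_eq_of_subset_D_of_meets hsubD hz hzD
    subst hf'
    rw [(I.ct f').hG]
    exact (cell_subset_of_subset_T (I.certH_subset_𝓗 f' j) hj).trans (subset_iUnion (fun j => polytope ((I.ct f').H j)) j)
  · rw [dif_neg htent] at hgrain
    -- the remaining branches put the cell inside a prism / gap piece / box, all disjoint from the territory of `f`
    exfalso
    by_cases hP : ∃ k : Fin rc.nk, μ.HP k ⊆ T
    · obtain ⟨k, hk⟩ := hP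
      have hsub := cell_subset_of_subset_T (I.HP_subset_𝓗 k) hk
      exact Set.disjoint_left.1 (μ.hDP f k) hzD (hsub hz)
    rw [dif_neg hP] at hgrain
    by_cases hQ : ∃ l : Fin μ.nQ, μ.HQ l ⊆ T
    · obtain ⟨l, hl⟩ := hQ
      have hsub := cell_subset_of_subset_T (I.HQ_subset_𝓗 l) hl
      exact Set.disjoint_left.1 (μ.hQD l f) (hsub hz) hzD
    rw [dif_neg hQ] at hgrain
    by_cases hB : ∃ r : Fin rc.nr, μ.HB r ⊆ T
    · obtain ⟨r, hr⟩ := hB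
      have hsub := cell_subset_of_subset_T (I.HB_subset_𝓗 r) hr
      exact Set.disjoint_left.1 (μ.hBD r f) (hsub hz) hzD
    rw [dif_neg hB] at hgrain
    simp at hgrain

/-! ### Every cell lies in an own slab of every grain; labelled-ness from the grain -/

/-- The polytopes of the bounded family lie in `bigSet`. -/
theorem polytope_subset_bigSet {G : Finset (E3 × ℝ)} (hG : G ∈ I.𝒢) : polytope G ⊆ I.bigSet := by
  simp only [𝒢, Finset.mem_union, Finset.mem_biUnion, Finset.mem_univ, true_and, Finset.mem_image] at hG
  intro z hz
  simp only [bigSet, mem_union, mem_iUnion]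
  rcases hG with ((((⟨f, j, rfl⟩ | ⟨f, j, rfl⟩) | ⟨k, rfl⟩) | ⟨l, rfl⟩) | ⟨r, rfl⟩) | ⟨f, j, rfl⟩
  · exact Or.inl (Or.inl (Or.inl (Or.inl ⟨f, j, hz⟩)))
  · obtain ⟨j', hj'⟩ := mem_iUnion.1 (μ.hCD f j hz)
    exact Or.inl (Or.inl (Or.inl (Or.inl ⟨f, j', hj'⟩)))
  · exact Or.inl (Or.inl (Or.inl (Or.inr ⟨k, hz⟩)))
  · exact Or.inl (Or.inl (Or.inr ⟨l, hz⟩))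
  · exact Or.inl (Or.inr ⟨r, hz⟩)
  · refine Or.inr ⟨f, ?_⟩
    rw [(I.ct f).hG]; exact mem_iUnion.2 ⟨j, hz⟩

/-- Cells lie in `bigSet`. -/
theorem cell_subset_bigSet (j : Fin I.cells.k) : I.cells.cell j ⊆ I.bigSet := by
  intro z hz
  obtain ⟨G, hG, hzG⟩ := mem_iUnion₂.1 (refineCells_subset I.𝓗 I.𝓗_unit I.𝒢 I.𝒢_subset_𝓗 I.𝒢_bounded I.n I.lab₀ j hz)
  exact I.polytope_subset_bigSet hG hzG

/-- The layer planes of a presentation form a null set. -/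
theorem volume_layerPlanes_eq_zero (L : E3 ≃ₗᵢ[ℝ] E3) (s : E3) :
    volume (⋃ i : ℤ, {y : E3 | ⟪L e₃, y⟫_ℝ = (i : ℝ) * TentCertificate.hB + ⟪L e₃, s⟫_ℝ}) = 0 := by
  have hne : L e₃ ≠ 0 := fun h => by have := norm_frame_e₃ L; rw [h, norm_zero] at this; exact zero_ne_one this
  exact measure_iUnion_null fun i => volume_setOf_inner_eq_zero hne _

/-- A point off the layer planes of `(L, s)` lies in some slab. -/
theorem exists_mem_laySlab_of_not_mem_planes (L : E3 ≃ₗᵢ[ℝ] E3) (s : E3) {z : E3}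
    (hz : z ∉ ⋃ i : ℤ, {y : E3 | ⟪L e₃, y⟫_ℝ = (i : ℝ) * TentCertificate.hB + ⟪L e₃, s⟫_ℝ}) : ∃ i : ℤ, z ∈ laySlab L s i := by
  have hh := TentCertificate.hB_pos
  have ht : TentCertificate.height L s z = ⟪L e₃, z⟫_ℝ - ⟪L e₃, s⟫_ℝ := height_eq_inner _ _ _
  refine ⟨⌊TentCertificate.height L s z / TentCertificate.hB⌋, ?_⟩
  rw [TentCertificate.mem_laySlab_iff]
  have h1 : (⌊TentCertificate.height L s z / TentCertificate.hB⌋ : ℝ) ≤ TentCertificate.height L s z / TentCertificate.hB := Int.floor_le _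
  have h2 : TentCertificate.height L s z / TentCertificate.hB < (⌊TentCertificate.height L s z / TentCertificate.hB⌋ : ℝ) + 1 :=
    Int.lt_floor_add_one _
  have hne : (⌊TentCertificate.height L s z / TentCertificate.hB⌋ : ℝ) * TentCertificate.hB ≠ TentCertificate.height L s z := by
    intro h
    apply hz
    refine mem_iUnion.2 ⟨⌊TentCertificate.height L s z / TentCertificate.hB⌋, ?_⟩
    simp only [mem_setOf_eq]
    linarith
  constructor
  · rcases lt_or_eq_of_le ((le_div_iff₀ hh).1 h1) with h | h
    · exact h
    · exact absurd h hne
  · have := (div_lt_iff₀ hh).1 h2; linarith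

/-- **Every nonempty cell lies in an own slab of every grain, with the slab's constraints in its positive part.** -/
theorem exists_laySlabH_subset_T (j : Fin I.cells.k) (f : Fin rc.ng) :
    ∃ i ∈ I.slabWindow f, laySlabH (rc.tent f).L (rc.tent f).s i ⊆ I.cells.T j := by
  -- a point of the (open, nonempty) cell off the layer planes
  have hopen : IsOpen (I.cells.cell j) := by
    unfold LabelledCells.cell polytope
    exact isOpen_biInter_finset fun q _ => isOpen_lt (continuous_const.inner continuous_id) continuous_const
  have hpos : 0 < volume (I.cells.cell j) := hopen.measure_pos volume (I.cells.hne j)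
  have hdiff : 0 < volume (I.cells.cell j \ ⋃ i : ℤ, {y : E3 | ⟪(rc.tent f).L e₃, y⟫_ℝ = (i : ℝ) * TentCertificate.hB + ⟪(rc.tent f).L e₃, (rc.tent f).s⟫_ℝ}) := by
    rw [measure_sdiff_null (volume_layerPlanes_eq_zero _ _)]; exact hpos
  obtain ⟨z, hzc, hzp⟩ := nonempty_of_measure_ne_zero hdiff.ne'
  obtain ⟨i, hzi⟩ := exists_mem_laySlab_of_not_mem_planes _ _ hzp
  have hi : i ∈ I.slabWindow f := by
    rw [mem_slabWindow_iff]; exact ⟨z, hzi, I.cell_subset_bigSet j hzc⟩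
  refine ⟨i, hi, subset_T_of_cell_subset (I.laySlabH_subset_𝓗 f hi) (I.cells.hne j) ?_⟩
  have hzi' : z ∈ polytope (laySlabH (rc.tent f).L (rc.tent f).s i) := by rw [← laySlab_eq_polytope]; exact hzi
  exact refineCells_subset_of_mem _ _ _ _ _ _ _ j (I.laySlabH_subset_𝓗 f hi) hzc hzi'

/-- **A cell with a grain is labelled.** -/
theorem isSome_lab_of_grainOf (j : Fin I.cells.k) {f : Fin rc.ng} (h : I.grainOf (I.cells.T j) = some f) : (I.cells.lab j).isSome = true := by
  obtain ⟨i, hi, hsub⟩ := I.exists_laySlabH_subset_T j f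
  show (I.lab₀ (I.cells.T j)).isSome = true
  unfold lab₀
  rw [h, Option.bind_some, I.slabOf_eq_some (I.cells.hne j) hi hsub, Option.map_some]
  rfl

/-- The grain is defined whenever one of the five branches applies. -/
theorem isSome_grainOf {T : Finset (E3 × ℝ)}
    (h : (∃ f : Fin rc.ng, ∃ j, μ.HC f j ⊆ T) ∨ (∃ f : Fin rc.ng, (∃ j, (I.ct f).H j ⊆ T) ∧ ∃ j', μ.HD f j' ⊆ T) ∨
      (∃ k : Fin rc.nk, μ.HP k ⊆ T) ∨ (∃ l : Fin μ.nQ, μ.HQ l ⊆ T) ∨ (∃ r : Fin rc.nr, μ.HB r ⊆ T)) :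
    (I.grainOf T).isSome = true := by
  classical
  unfold grainOf
  split_ifs with h1 h2 h3 h4 h5 <;> simp_all

/-- **Cells inside a core, a prism, a gap piece or a box are labelled.** -/
theorem isSome_lab_of_subset (j : Fin I.cells.k) {G : Finset (E3 × ℝ)} (hG𝓗 : G ⊆ I.𝓗)
    (hG : (∃ f j', G = μ.HC f j') ∨ (∃ k, G = μ.HP k) ∨ (∃ l, G = μ.HQ l) ∨ (∃ r, G = μ.HB r)) (hsub : I.cells.cell j ⊆ polytope G) :
    (I.cells.lab j).isSome = true := by
  have hT : G ⊆ I.cells.T j := subset_T_of_cell_subset hG𝓗 (I.cells.hne j) hsub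
  have hgr : (I.grainOf (I.cells.T j)).isSome = true := by
    refine I.isSome_grainOf ?_
    rcases hG with ⟨f, j', rfl⟩ | ⟨k, rfl⟩ | ⟨l, rfl⟩ | ⟨r, rfl⟩
    · exact Or.inl ⟨f, j', hT⟩
    · exact Or.inr (Or.inr (Or.inl ⟨k, hT⟩))
    · exact Or.inr (Or.inr (Or.inr (Or.inl ⟨l, hT⟩)))
    · exact Or.inr (Or.inr (Or.inr (Or.inr ⟨r, hT⟩)))
  obtain ⟨f, hf⟩ := Option.isSome_iff_exists.1 hgr
  exact I.isSome_lab_of_grainOf j hf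

end TexInput

end Summit.Ventures.Crystal3D.Cruxes.TextureLiminf.TexShadow

end
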